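import Mathlib
import Literature.Analysis.FluidPDE.AlbrittonKatoClassLocalLeray
import Literature.Analysis.FluidPDE.NSCriticalClosureBesovBounded
import Literature.Analysis.FluidPDE.TaoLocalisationHolds
import Summits.NavierStokesRegularity.NavierStokesRegularity.Theorems.L3TimeExponentPincerJawMorreyRateHolds
import HarnessLib.Audit
import HarnessLib

/-!
# The first bite is currency-free on the Morrey axis: `∃ q > 4, u ∈ L^q_t L³_x ⟺ ∃ a > 2, Φ ∈ L^a_t`
# (route `L3TimeExponentPincer`, parent crux `L3CascadeJaw` stmt-NavierStokesRegularity-19499; support file 13 of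
# seat p4 — the arrow F1 ⇒ F2 of nsreg-p2 ROUND-10 §1, the only one left at memo level)

Support file (cell ns-regularity-ideate, seat p4, gen 5).  0 `sorry`, no definitions.

nsreg-p2 ROUND-10 tabulates the currencies of the crux's first bite «`u ∈ L^q_t L³_x` near `T` for SOME `q > 4`»:
Morrey rate (F2: `Φ ∈ L^a_t`, `a > 2`, THEOREM J″ `jaw_of_morreyRate_holds` gives F2 ⇒ F1 with `q = 6a/(1+a)`),
dissipation (`…DissipationAxis.l3Bite_of_dissipBite`), mixed norms (`…MixedNormBite.l3Bite_of_mixedBite`).  This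
file proves the converse arrow on the Morrey axis, F1 ⇒ F2, by Hölder on balls:

* `lintegral_ball_sq_le_of_eLpNorm_three` — `∫_{B(x₀,r)} |f|² ≤ ‖f‖₃² · (V₁ r³)^{1/3}` (pure; `L² ⊂ L³` on a set
  of finite measure, the tree's `lintegral_enorm_sq_le_sq_eLpNorm_mul`);
* `measurable_l3cube_of_frame` — `t ↦ ‖u(t)‖₃³`, extended by `0` off `[0,T)`, is MEASURABLE (not only a.e.):
  the velocity is continuous on the slab, so its indicator-extension is Borel and Tonelli applies;
* `eLpNorm_three_lt_top_of_frame` — `‖u(t)‖₃ < ∞` for every `t ∈ [0,T)` (Tao's closed-slab sup bound ×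
  the energy);
* `morreyRateNear_l3sq_of_frame` — every frame solution carries the MEASURABLE all-radii Morrey rate
  `Φ(t) = V₁^{1/3} ‖u(t)‖₃²` (`MorreyRateNear u T Φ` with `r₁ = 1`);
* **`morreyBite_of_l3Bite`** — F1 ⇒ F2: `∫_{T₂}^{T} ‖u‖₃^q < ∞` with `q > 4` gives the Morrey rate `Φ` above with
  `∫ Φ^{q/2} < ∞`, `a = q/2 > 2`; with J″ (F2 ⇒ F1) **`l3Bite_iff_morreyBite`**: the first bite in `L^q_t L³_x` and
  in Morrey-rate integrability are EQUIVALENT (round trip `q ↦ q/2 ↦ 6q/(q+2) < q`: equivalent as bites, not as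
  exponents).

WHAT THIS IS NOT: not a claim about Navier–Stokes regularity; bookkeeping between hypotheses, no item closed.
-/

noncomputable section

namespace Summit.NavierStokesRegularity.NavierStokesRegularity.Theorems.L3TimeExponentPincerL3BiteMorreyRate

open MeasureTheory Set Function Filter Metric Topology
open scoped ENNReal NNReal
open Literature.Analysis.FluidPDE
open Summit.NavierStokesRegularity.NavierStokesRegularity.Theorems.L3TimeExponentPincerMorreyGrowth (V₁ V₁_nonneg volume_ball_eq)
open Summit.NavierStokesRegularity.NavierStokesRegularity.Theorems.L3TimeExponentPincerJawFullMorrey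
  (eLpNorm_three_rpow_eq)
open Summit.NavierStokesRegularity.NavierStokesRegularity.Theorems.L3TimeExponentPincerJawMorreyRate (MorreyRateNear)
open Summit.NavierStokesRegularity.NavierStokesRegularity.Theorems.L3TimeExponentPincerJawMorreyRateHolds
  (jaw_of_morreyRate_holds)

/-! ## §1  Hölder on balls -/

/-- **`L² ⊂ L³` on a ball**: `∫_{B(x₀,r)} ‖f‖² ≤ ‖f‖₃² · (V₁ r³)^{1/3}` for a.e.-strongly measurable `f`. -/
theorem lintegral_ball_sq_le_of_eLpNorm_three {f : (EuclideanSpace ℝ (Fin 3)) → (EuclideanSpace ℝ (Fin 3))}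
    (hf : AEStronglyMeasurable f volume) (x₀ : EuclideanSpace ℝ (Fin 3)) {r : ℝ} (hr : 0 < r) :
    ∫⁻ x in ball x₀ r, ‖f x‖ₑ ^ 2 ≤
      eLpNorm f 3 volume ^ 2 * ENNReal.ofReal ((r ^ 3 * V₁) ^ (1 / 3 : ℝ)) := by
  have h := lintegral_enorm_sq_le_sq_eLpNorm_mul (μ := volume.restrict (ball x₀ r)) hf.restrict
    (p := 3) (by norm_num)
  rw [Measure.restrict_apply_univ, volume_ball_eq x₀ hr] at h
  have h13 : (1 / 2 - 1 / (3 : ℝ≥0∞).toReal : ℝ) = 1 / 6 := by norm_num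
  rw [h13] at h
  calc ∫⁻ x in ball x₀ r, ‖f x‖ₑ ^ 2
      ≤ (eLpNorm f 3 (volume.restrict (ball x₀ r)) * ENNReal.ofReal (r ^ 3 * V₁) ^ (1 / 6 : ℝ)) ^ 2 := h
    _ ≤ (eLpNorm f 3 volume * ENNReal.ofReal (r ^ 3 * V₁) ^ (1 / 6 : ℝ)) ^ 2 := by
        gcongr; exact Measure.restrict_le_self
    _ = eLpNorm f 3 volume ^ 2 * ENNReal.ofReal ((r ^ 3 * V₁) ^ (1 / 3 : ℝ)) := by
        rw [mul_pow]
        congr 1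
        rw [← ENNReal.rpow_natCast, ← ENNReal.rpow_mul,
          ENNReal.ofReal_rpow_of_nonneg (mul_nonneg (pow_nonneg hr.le 3) V₁_nonneg) (by norm_num)]
        norm_num

/-! ## §2  Measurability and finiteness of `t ↦ ‖u(t)‖₃` for frame solutions -/

/-- **`t ↦ ∫ |u(t)|³` (extended by `0` off the slab) is measurable** for a classical solution on `[0,T)`:
the indicator-extension of `(t,x) ↦ ‖u(t,x)‖ₑ³` off `[0,T) × ℝ³` is Borel (continuous on the measurable slab,
zero off it), and Tonelli (`Measurable.lintegral_prod_right'`) applies. -/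
theorem measurable_l3cube_of_frame {ν T : ℝ}
    {u : ℝ → (EuclideanSpace ℝ (Fin 3)) → (EuclideanSpace ℝ (Fin 3))} {p : ℝ → (EuclideanSpace ℝ (Fin 3)) → ℝ}
    (hcl : IsClassicalNSSolutionOn (Ico 0 T) ν 0 u p) :
    ∃ F : ℝ → ℝ≥0∞, Measurable F ∧ ∀ t ∈ Ico 0 T, F t = ∫⁻ x, ‖u t x‖ₑ ^ (3 : ℕ) := by
  set s : Set (ℝ × EuclideanSpace ℝ (Fin 3)) := Ico 0 T ×ˢ univ with hs
  have hsm : MeasurableSet s := measurableSet_Ico.prod MeasurableSet.univ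
  set G : ℝ × EuclideanSpace ℝ (Fin 3) → ℝ≥0∞ := s.indicator fun z => ‖uncurry u z‖ₑ ^ (3 : ℕ) with hG
  have hGm : Measurable G := by
    refine measurable_of_restrict_of_restrict_compl hsm ?_ ?_
    · have hc : Continuous (s.restrict (uncurry u)) := hcl.smooth_velocity.continuousOn.restrict
      have h1 : s.restrict G = fun z => ‖s.restrict (uncurry u) z‖ₑ ^ (3 : ℕ) := by
        funext z
        simp only [restrict_apply, hG, indicator_of_mem z.2]
      rw [h1]
      exact ((ENNReal.continuous_pow 3).comp (continuous_enorm.comp hc)).measurable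
    · have h2 : sᶜ.restrict G = fun _ => 0 := by
        funext z
        simp only [restrict_apply, hG, indicator_of_notMem (show (z : ℝ × _) ∉ s from z.2)]
      rw [h2]
      exact measurable_const
  refine ⟨fun t => ∫⁻ x, G (t, x), hGm.lintegral_prod_right', fun t ht => ?_⟩
  refine lintegral_congr fun x => ?_
  simp only [hG, indicator_of_mem (show ((t, x) : ℝ × _) ∈ s from ⟨ht, mem_univ _⟩), uncurry_apply_pair]

/-- **`‖u(t)‖₃ < ∞` at every `t ∈ [0,T)`** for a frame solution (classical on `[0,T)`, Leray–Hopf, rapidly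
decaying datum): Tao's closed-slab sup bound `|u| ≤ M` on `[0,T'] × ℝ³` and the energy give
`∫|u(t)|³ ≤ M ∫|u(t)|² < ∞`. -/
theorem eLpNorm_three_lt_top_of_frame {ν T : ℝ} (hν : 0 < ν)
    {u : ℝ → (EuclideanSpace ℝ (Fin 3)) → (EuclideanSpace ℝ (Fin 3))} {p : ℝ → (EuclideanSpace ℝ (Fin 3)) → ℝ}
    (hcl : IsClassicalNSSolutionOn (Ico 0 T) ν 0 u p) (hLH : IsLerayHopfOn T ν 0 (u 0) u)
    (hdec : HasRapidSpatialDecay (u 0)) {t : ℝ} (ht : t ∈ Ico 0 T) :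
    eLpNorm (u t) 3 volume < ⊤ := by
  have hT' : (t + T) / 2 ∈ Ioo 0 T := ⟨by linarith [ht.1, ht.2], by linarith [ht.2]⟩
  obtain ⟨M, hM⟩ := exists_forall_norm_le_of_tao2011 tao2011_hasBoundedSobolevNormsOn_holds hν hcl hLH hdec
    _ hT'
  have htI : t ∈ Icc 0 ((t + T) / 2) := ⟨ht.1, by linarith [ht.2]⟩
  have hMnn : 0 ≤ M := (norm_nonneg _).trans (hM t htI 0)
  have hE : ∫⁻ x, ‖u t x‖ₑ ^ 2 ≤ ENNReal.ofReal (2 * VectorCalculus.kineticEnergy (u 0)) :=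
    hLH.lintegral_enorm_sq_le hν.le ⟨ht.1, ht.2.le⟩
  have h3 : ∫⁻ x, ‖u t x‖ₑ ^ (3 : ℕ) ≤ ENNReal.ofReal M * ∫⁻ x, ‖u t x‖ₑ ^ 2 := by
    rw [← lintegral_const_mul' _ _ ENNReal.ofReal_ne_top]
    refine lintegral_mono fun x => ?_
    rw [pow_succ, mul_comm]
    gcongr
    rw [← ofReal_norm]
    exact ENNReal.ofReal_le_ofReal (hM t htI x)
  have hfin : ∫⁻ x, ‖u t x‖ₑ ^ (3 : ℕ) < ⊤ :=
    lt_of_le_of_lt h3 (ENNReal.mul_lt_top ENNReal.ofReal_lt_top (lt_of_le_of_lt hE ENNReal.ofReal_lt_top))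
  have h1 : eLpNorm (u t) 3 volume = (∫⁻ x, ‖u t x‖ₑ ^ (3 : ℕ)) ^ (1 / 3 : ℝ) := by
    have := eLpNorm_three_rpow_eq volume (u t) 1
    rw [ENNReal.rpow_one] at this
    exact this
  rw [h1]
  exact ENNReal.rpow_lt_top_of_nonneg (by norm_num) hfin.ne

/-! ## §3  The `L³`-square Morrey rate and F1 ⇒ F2 -/

/-- **Every frame solution carries the measurable all-radii Morrey rate `Φ(t) = V₁^{1/3} ‖u(t)‖₃²`**: there is a
measurable `Φ : ℝ → ℝ≥0` with `MorreyRateNear u T Φ` and `Φ t = V₁^{1/3} ‖u(t)‖₃²` (as reals) on `(0,T)`. -/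
theorem morreyRateNear_l3sq_of_frame {ν T : ℝ} (hν : 0 < ν) (hT : 0 < T)
    {u : ℝ → (EuclideanSpace ℝ (Fin 3)) → (EuclideanSpace ℝ (Fin 3))} {p : ℝ → (EuclideanSpace ℝ (Fin 3)) → ℝ}
    (hcl : IsClassicalNSSolutionOn (Ico 0 T) ν 0 u p) (hLH : IsLerayHopfOn T ν 0 (u 0) u)
    (hdec : HasRapidSpatialDecay (u 0)) :
    ∃ Φ : ℝ → ℝ≥0, Measurable Φ ∧ MorreyRateNear u T Φ ∧
      ∀ t ∈ Ioo 0 T, (Φ t : ℝ≥0∞) = ENNReal.ofReal (V₁ ^ (1 / 3 : ℝ)) * eLpNorm (u t) 3 volume ^ 2 := by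
  obtain ⟨F, hFm, hF⟩ := measurable_l3cube_of_frame hcl
  have hV : 0 ≤ V₁ := V₁_nonneg
  -- `Φ t = (V₁^{1/3} (F t)^{2/3}).toNNReal`
  set Φ : ℝ → ℝ≥0 := fun t => (ENNReal.ofReal (V₁ ^ (1 / 3 : ℝ)) * F t ^ (2 / 3 : ℝ)).toNNReal with hΦ
  have hΦm : Measurable Φ := ((hFm.pow_const _).const_mul _).ennreal_toNNReal
  -- on `(0,T)`: `F t ^ {2/3} = ‖u(t)‖₃²`, finite
  have hFt : ∀ t ∈ Ioo 0 T, F t ^ (2 / 3 : ℝ) = eLpNorm (u t) 3 volume ^ 2 := by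
    intro t ht
    rw [hF t ⟨ht.1.le, ht.2⟩, ← ENNReal.rpow_two, eLpNorm_three_rpow_eq volume (u t) 2]
  have hΦt : ∀ t ∈ Ioo 0 T, (Φ t : ℝ≥0∞) = ENNReal.ofReal (V₁ ^ (1 / 3 : ℝ)) * eLpNorm (u t) 3 volume ^ 2 := by
    intro t ht
    have hne : ENNReal.ofReal (V₁ ^ (1 / 3 : ℝ)) * eLpNorm (u t) 3 volume ^ 2 ≠ ⊤ :=
      ENNReal.mul_ne_top ENNReal.ofReal_ne_top
        (ENNReal.pow_ne_top (eLpNorm_three_lt_top_of_frame hν hcl hLH hdec ⟨ht.1.le, ht.2⟩).ne)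
    show ((ENNReal.ofReal (V₁ ^ (1 / 3 : ℝ)) * F t ^ (2 / 3 : ℝ)).toNNReal : ℝ≥0∞) = _
    rw [hFt t ht, ENNReal.coe_toNNReal hne]
  refine ⟨Φ, hΦm, ⟨1, one_pos, 0, hT, fun t ht x₀ r hr _ => ?_⟩, hΦt⟩
  have hmeas : AEStronglyMeasurable (u t) volume :=
    (hcl.contDiff_velocity ⟨ht.1.le, ht.2⟩).continuous.aestronglyMeasurable
  calc ∫⁻ x in ball x₀ r, ‖u t x‖ₑ ^ 2
      ≤ eLpNorm (u t) 3 volume ^ 2 * ENNReal.ofReal ((r ^ 3 * V₁) ^ (1 / 3 : ℝ)) :=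
        lintegral_ball_sq_le_of_eLpNorm_three hmeas x₀ hr
    _ = ENNReal.ofReal ((Φ t : ℝ) * r) := by
        have h3 : (r ^ 3 * V₁) ^ (1 / 3 : ℝ) = r * V₁ ^ (1 / 3 : ℝ) := by
          rw [Real.mul_rpow (by positivity) hV, ← Real.rpow_natCast r 3, ← Real.rpow_mul hr.le]
          norm_num
        rw [h3, ENNReal.ofReal_mul (Φ t).coe_nonneg, ENNReal.ofReal_coe_nnreal, hΦt t ht,
          ENNReal.ofReal_mul hr.le]
        ring

/-- **F1 ⇒ F2 (first bite: `L^q_t L³_x` ⇒ Morrey-rate integrability).**  For a frame solution (classical on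
`[0,T)`, Leray–Hopf, rapidly decaying datum): if `∫_{T₂}^{T} ‖u(t)‖₃^q dt < ∞` for some `q > 4`, then the
measurable Morrey rate `Φ = V₁^{1/3}‖u‖₃²` of `morreyRateNear_l3sq_of_frame` satisfies `∫ Φ^{a} < ∞` with
`a = q/2 > 2`. -/
theorem morreyBite_of_l3Bite {ν T : ℝ} (hν : 0 < ν) (hT : 0 < T)
    {u : ℝ → (EuclideanSpace ℝ (Fin 3)) → (EuclideanSpace ℝ (Fin 3))} {p : ℝ → (EuclideanSpace ℝ (Fin 3)) → ℝ}
    (hcl : IsClassicalNSSolutionOn (Ico 0 T) ν 0 u p) (hLH : IsLerayHopfOn T ν 0 (u 0) u)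
    (hdec : HasRapidSpatialDecay (u 0)) {q : ℝ} (hq4 : 4 < q)
    (hint : ∃ T₂ < T, ∫⁻ t in Ioo T₂ T, eLpNorm (u t) 3 volume ^ q < ⊤) :
    ∃ Φ : ℝ → ℝ≥0, Measurable Φ ∧ MorreyRateNear u T Φ ∧ ∃ a : ℝ, 2 < a ∧
      ∃ T₁ < T, ∫⁻ t in Ioo T₁ T, (Φ t : ℝ≥0∞) ^ a < ⊤ := by
  obtain ⟨Φ, hΦm, hΦ, hΦt⟩ := morreyRateNear_l3sq_of_frame hν hT hcl hLH hdec
  obtain ⟨T₂, hT₂, hint⟩ := hint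
  have hq0 : 0 ≤ q / 2 := by linarith
  refine ⟨Φ, hΦm, hΦ, q / 2, by linarith, max T₂ 0, max_lt hT₂ hT, ?_⟩
  set C : ℝ≥0∞ := ENNReal.ofReal (V₁ ^ (1 / 3 : ℝ)) ^ (q / 2) with hC
  have hCtop : C ≠ ⊤ := ENNReal.rpow_ne_top_of_nonneg hq0 ENNReal.ofReal_ne_top
  have hpt : ∀ t ∈ Ioo (max T₂ 0) T, (Φ t : ℝ≥0∞) ^ (q / 2) = C * eLpNorm (u t) 3 volume ^ q := by
    intro t ht
    have ht0 : t ∈ Ioo 0 T := ⟨lt_of_le_of_lt (le_max_right _ _) ht.1, ht.2⟩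
    rw [hΦt t ht0, ENNReal.mul_rpow_of_nonneg _ _ hq0, hC, ← ENNReal.rpow_two, ← ENNReal.rpow_mul]
    congr 2
    ring
  calc ∫⁻ t in Ioo (max T₂ 0) T, (Φ t : ℝ≥0∞) ^ (q / 2)
      = ∫⁻ t in Ioo (max T₂ 0) T, C * eLpNorm (u t) 3 volume ^ q := setLIntegral_congr_fun measurableSet_Ioo hpt
    _ = C * ∫⁻ t in Ioo (max T₂ 0) T, eLpNorm (u t) 3 volume ^ q := lintegral_const_mul' _ _ hCtop
    _ ≤ C * ∫⁻ t in Ioo T₂ T, eLpNorm (u t) 3 volume ^ q :=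
        mul_le_mul_of_nonneg_left (lintegral_mono_set (Ioo_subset_Ioo_left (le_max_left _ _))) bot_le
    _ < ⊤ := ENNReal.mul_lt_top hCtop.lt_top hint

/-- **The first bite is the same bite in both currencies**: for a frame solution,
`(∃ q > 4, u ∈ L^q_t L³_x near T) ⟺ (∃ measurable Morrey rate Φ, ∃ a > 2, ∫ Φ^a < ∞ near T)`
(`⇒` = `morreyBite_of_l3Bite`; `⇐` = THEOREM J″ `jaw_of_morreyRate_holds` with `q = 6a/(1+a) > 4`). -/
theorem l3Bite_iff_morreyBite {ν T : ℝ} (hν : 0 < ν) (hT : 0 < T)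
    {u : ℝ → (EuclideanSpace ℝ (Fin 3)) → (EuclideanSpace ℝ (Fin 3))} {p : ℝ → (EuclideanSpace ℝ (Fin 3)) → ℝ}
    (hcl : IsClassicalNSSolutionOn (Ico 0 T) ν 0 u p) (hLH : IsLerayHopfOn T ν 0 (u 0) u)
    (hdec : HasRapidSpatialDecay (u 0)) :
    (∃ q : ℝ, 4 < q ∧ ∃ T₂ < T, ∫⁻ t in Ioo T₂ T, eLpNorm (u t) 3 volume ^ q < ⊤) ↔
      ∃ Φ : ℝ → ℝ≥0, Measurable Φ ∧ MorreyRateNear u T Φ ∧ ∃ a : ℝ, 2 < a ∧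
        ∃ T₁ < T, ∫⁻ t in Ioo T₁ T, (Φ t : ℝ≥0∞) ^ a < ⊤ := by
  constructor
  · rintro ⟨q, hq4, hint⟩
    exact morreyBite_of_l3Bite hν hT hcl hLH hdec hq4 hint
  · rintro ⟨Φ, hΦm, hΦ, a, ha2, T₁, hT₁, hint⟩
    have ha1 : 0 < 1 + a := by linarith
    set q : ℝ := 6 * a / (1 + a) with hq
    have hq4 : 4 < q := by rw [hq, lt_div_iff₀ ha1]; linarith
    have hq6 : q < 6 := by rw [hq, div_lt_iff₀ ha1]; linarith
    have hqa : q / (6 - q) = a := by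
      rw [hq]
      field_simp
      ring
    obtain ⟨T₂, hT₂, h⟩ := jaw_of_morreyRate_holds hν hT hcl hLH hΦm hΦ (by linarith) hq6
      ⟨T₁, hT₁, by rw [hqa]; exact hint⟩
    exact ⟨q, hq4, T₂, hT₂.2, h⟩

end Summit.NavierStokesRegularity.NavierStokesRegularity.Theorems.L3TimeExponentPincerL3BiteMorreyRate

end
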